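import Mathlib
import Summits.KontsevichZagierPeriods.Zeta5Search.LevelClassDigits
import Summits.KontsevichZagierPeriods.Zeta5Search.ClassTypeCover
import Summits.KontsevichZagierPeriods.Zeta5Search.GHatMomentsProof
import Summits.KontsevichZagierPeriods.Zeta5Search.CasoratianClassBoundProof
import Summits.KontsevichZagierPeriods.Zeta5Search.MixedPairTermwiseProof
import Summits.KontsevichZagierPeriods.Zeta5Search.RecordCellAAtlasNotMin
import HarnessLib

/-!
# ζ(5) search — the V-CARRIER AGGREGATE BONUS: when the deepest classes are single-pole level classes of ONE type, `v_p(V(b)) ≥ VB + 1` from the moment lemma, and the Casoratian from `V`-bounds (generic in `b`)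

Cell `pub-zeta5` (HONEST FRAMING: systematic search; no irrationality claim unless certified), TRACK «DENOM-LAW» D1 prover seat
(denom-prover-d1 g12, `HOME/denom-law/prover-d1/ATTEMPT-12.md` §5).  Generic glue, all `b` in the polytope, assembled from LANDED theorems
only (`LevelClassDigits.v_digit_level` = the universal `V`-digit on a level class, `gHat_conj_level`, `GHatMomentsProof.gHatMoments_holds`
= the mod-`p` moment lemma, THEOREM LB's row bookkeeping of `CasoratianClassBoundProof`/`OrbitCreditCasoratian`):
* §1 `padicNorm_sum_classV_carriers_le` / `padicNorm_coeffV_le_of_carriers`: if a set `D` of residues consists of level classes of one common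
  centre-free type `T` (class exponent `m = ΣT`, at least one pole) — the `V`-CARRIERS — every other pole class has `ν ≥ m + 1`, and the carrier
  units satisfy `Σ_{x∈D} ĝ_x ≡ 0 (mod p)`, then `‖V(b)‖_p ≤ p^{−(m+1)}`: the carriers' first digits `ĝ_x·v̂(T)` (one common type constant `v̂(T)`,
  never evaluated) cancel IN AGGREGATE.
* §2 `gHat_carrier_sum_le`: the aggregate congruence `Σ_D ĝ ≡ 0` from the moment lemma at depth `N = −m` (degree range `(N−1)p ≤ 2d+3`) when
  the depth-`N` classes split as `D ⊔ φ(D)` with `ĝ_{φ x} ≡ ĝ_x` — e.g. `φ` = conjugation and `m` odd (`gHat_conj_carrier`: `ĝ_x̄ ≡ (−1)^{m+1}ĝ_x`).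
* §3 `cas_val_ge_of_coeffV`: `v_p(Cas_j(b)) ≥ v + r` from `‖V(b)‖, ‖V(b+e_j)‖ ≤ p^{−v}` and a row constant `r` (`r ≤ 1`, `r ≤ 3 + E_x` on multipole
  classes, `r ≤ 0` if `p > d + 1`) — THEOREM LB's assembly with the `V`-bounds as input (verbatim the rows/Ω-bracket of `casoratianOrbitBound_holds`).
* §4 `isType_shift_of_classExp_eq`: a typed class not hit by the shift `b ↦ b + e_j` keeps its type.
This is the ODD-`VB` sibling of the landed `PalindromicVCarrierBonus` (`PalindromicVCarrierBonusProof`: there `N = −VB` is EVEN and the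
carriers cancel in conjugate PAIRS by `padicNorm_classV_pair_le`; here `ĝ_x̄ ≡ +ĝ_x`, nothing cancels pairwise, and the carriers cancel only in
AGGREGATE, by the residue theorem over `𝔽_p` in the form of the moment lemma — so the degree range is a genuine hypothesis).
First consumer: the flag-ray cell `17n < p ≤ 17.5n` (`DenomLaw/FlagRayPathC17a`), where the minimum `VB = −5` is carried by the non-tame
single-pole classes `[0,−6,1]` whose conjugates `[1,−6,0]` are tame, and `4p ≤ 2d + 3` is exactly `p ≤ 17.5n`.  `p`-adic valuations of the cell's own rationals; nothing about ζ(5);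
no γ; records in print UNMOVED.
-/

open Finset

namespace Summit.KontsevichZagierPeriods.Zeta5Search.ClusterValuation.VCarrier

open Summit.KontsevichZagierPeriods.Zeta5Search.ClusterValuation
open Summit.KontsevichZagierPeriods.Zeta5Search.CasoratianValuation (InPolytope shift casoratian)
open Summit.KontsevichZagierPeriods.Zeta5Search.WedgeDictionary (coeffV dOf)
open Summit.KontsevichZagierPeriods.Zeta5Search.DualSeries (InBox)
open Summit.KontsevichZagierPeriods.Zeta5Search.PadicSeries (one_le_p zpow_p_nonneg)
open Summit.KontsevichZagierPeriods.Zeta5Search.BigPrime (shift_zero dOf_shift)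
open Summit.KontsevichZagierPeriods.Zeta5Search.ClassTypeCover
open Summit.KontsevichZagierPeriods.Zeta5Search.LevelClass
open Summit.KontsevichZagierPeriods.Zeta5Search.CellA (small_add small_sub small_mul classExp_le_classNu)

variable {p : ℕ} [hp : Fact p.Prime]

/-! ## §0 Small helpers -/

/-- `pCong` in norm form: `r ≡ 0 (mod p)` gives `‖r‖ ≤ p⁻¹`. -/
theorem padicNorm_le_of_pCong {r : ℚ} (h : pCong p r = true) : padicNorm p r ≤ (p : ℚ) ^ (-(1 : ℤ)) := by
  unfold pCong at h
  rcases of_decide_eq_true h with h0 | h1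
  · rw [h0, padicNorm.zero]; exact zpow_p_nonneg _
  · exact padicNorm_le_of_val fun _ => h1

/-- `‖2·s‖ = ‖s‖` for an odd prime. -/
theorem padicNorm_two_mul (hp5 : 5 ≤ p) (s : ℚ) : padicNorm p (2 * s) = padicNorm p s := by
  rw [padicNorm.mul]
  have h2 : padicNorm p (2 : ℚ) = 1 := by
    have : padicNorm p ((2 : ℕ) : ℚ) = 1 := (padicNorm.nat_eq_one_iff (p := p) (m := 2)).2 (by
      intro h; have := Nat.le_of_dvd (by norm_num) h; omega)
    simpa using this
  rw [h2, one_mul]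

omit hp in
/-- Level data of a typed centre-free class, in the format of `LevelClassDigits` (`L = |T| − 1`, `e_k = T_k`). -/
theorem levelData {b : ℕ → ℤ} {x : ℕ} {T : List ℤ} (h : IsType b p x T false) :
    x < p ∧ x + (T.length - 1) * p ≤ (b 0).toNat ∧ (b 0).toNat < x + (T.length - 1) * p + p ∧
    (∀ k ≤ T.length - 1, netExp b (x + k * p) = T.getD k 0) ∧ ¬ CentreIn b p x := by
  refine ⟨h.lt, h.top, h.top', fun k hk => h.lev k (by have := h.pos; omega), fun hc => ?_⟩
  have := h.cen_iff.1 hc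
  exact Bool.false_ne_true this

/-- `E(T) = ΣT` in the `typeExp` format. -/
theorem typeExp_getD (T : List ℤ) (hT : 0 < T.length) :
    typeExp (T.length - 1) (fun k => T.getD k 0) = T.sum := by
  unfold typeExp
  rw [show T.length - 1 + 1 = T.length by omega]
  exact sum_range_getD T

/-- A type with a negative entry has a pole index `i₀ ≤ L`. -/
theorem exists_neg_index (T : List ℤ) (hneg : ∃ v ∈ T, v < 0) :
    ∃ i₀, i₀ ≤ T.length - 1 ∧ T.getD i₀ 0 < 0 := by
  obtain ⟨v, hv, hv0⟩ := hneg
  obtain ⟨i, hi, rfl⟩ := List.mem_iff_getElem.1 hv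
  refine ⟨i, by omega, ?_⟩
  rw [List.getD_eq_getElem?_getD, List.getElem?_eq_getElem hi]
  simpa using hv0

/-! ## §1 The carriers' digits cancel in aggregate -/

/-- **Aggregate digit bound.**  If every `x ∈ D` is a level class of the common centre-free type `T` (with a pole), then
`‖Σ_{x∈D} V_x‖ ≤ p^{−(ΣT+1)}` as soon as `‖Σ_{x∈D} ĝ_x‖ ≤ p⁻¹`. -/
theorem padicNorm_sum_classV_carriers_le (b : ℕ → ℤ) (hb : InPolytope b) (hp5 : 5 ≤ p)
    (hwin : (b 0 + 2 : ℤ) < (p : ℤ) ^ 2) (D : Finset ℕ) (T : List ℤ)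
    (hT : ∀ x ∈ D, IsType b p x T false) (hneg : ∃ v ∈ T, v < 0)
    (hsum : padicNorm p (∑ x ∈ D, gHat b p x) ≤ (p : ℚ) ^ (-(1 : ℤ))) :
    padicNorm p (∑ x ∈ D, classV b p x) ≤ (p : ℚ) ^ (-(T.sum + 1)) := by
  rcases D.eq_empty_or_nonempty with hD | ⟨x₀, hx₀⟩
  · rw [hD, sum_empty, padicNorm.zero]; exact zpow_p_nonneg _
  obtain ⟨hbox, -, -, hn⟩ := thmA_data b hb hwin
  have hp2 : p ≠ 2 := by omega
  have hp' : (-(p : ℚ)) ≠ 0 := neg_ne_zero.2 (Nat.cast_ne_zero.2 hp.out.ne_zero)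
  set L := T.length - 1 with hLdef
  set e : ℕ → ℤ := fun k => T.getD k 0 with hedef
  have hpos : 0 < T.length := (hT x₀ hx₀).pos
  obtain ⟨i₀, hi₀, hi₀neg⟩ := exists_neg_index T hneg
  have hE : typeExp L e = T.sum := typeExp_getD T hpos
  -- the digit of each carrier, with `g = ĝ_x`
  have hdig : ∀ x ∈ D, padicNorm p ((-(p : ℚ)) ^ (-T.sum) * classV b p x - gHat b p x * typeV L e)
      ≤ (p : ℚ) ^ (-(1 : ℤ)) := by
    intro x hx
    obtain ⟨hxp, hL, hL', he, hc⟩ := levelData (hT x hx)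
    have h := v_digit_level b hxp hL hL' hb hp5 hwin e he hc hi₀ hi₀neg (g := gHat b p x)
      (by rw [sub_self, padicNorm.zero]; exact zpow_p_nonneg _)
    rwa [hE] at h
  -- the common type constant is `p`-integral
  have htV : padicNorm p (typeV L e) ≤ 1 := by
    obtain ⟨hxp, hL, hL', he, hc⟩ := levelData (hT x₀ hx₀)
    rw [← vHat_level b hxp hL hL' e he hc]
    exact padicNorm_vHat_le_one b hbox.1 hn hp2
  -- sum of the digit statements
  have h1 : padicNorm p ((-(p : ℚ)) ^ (-T.sum) * ∑ x ∈ D, classV b p x - (∑ x ∈ D, gHat b p x) * typeV L e)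
      ≤ (p : ℚ) ^ (-(1 : ℤ)) := by
    rw [mul_sum, sum_mul, ← sum_sub_distrib]
    exact padicNorm.sum_le' hdig (zpow_p_nonneg _)
  have h2 : padicNorm p ((∑ x ∈ D, gHat b p x) * typeV L e) ≤ (p : ℚ) ^ (-(1 : ℤ)) := by
    rw [mul_comm]; exact small_mul htV hsum
  have h3 : padicNorm p ((-(p : ℚ)) ^ (-T.sum) * ∑ x ∈ D, classV b p x) ≤ (p : ℚ) ^ (-(1 : ℤ)) := by
    have e1 : (-(p : ℚ)) ^ (-T.sum) * ∑ x ∈ D, classV b p x =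
        ((-(p : ℚ)) ^ (-T.sum) * ∑ x ∈ D, classV b p x - (∑ x ∈ D, gHat b p x) * typeV L e)
          + (∑ x ∈ D, gHat b p x) * typeV L e := by ring
    rw [e1]; exact small_add h1 h2
  have e2 : ∑ x ∈ D, classV b p x = (-(p : ℚ)) ^ T.sum * ((-(p : ℚ)) ^ (-T.sum) * ∑ x ∈ D, classV b p x) := by
    rw [← mul_assoc, ← zpow_add₀ hp', add_neg_cancel, zpow_zero, one_mul]
  rw [e2, padicNorm.mul, LevelClass.padicNorm_neg_p_zpow]
  calc (p : ℚ) ^ (-T.sum) * padicNorm p ((-(p : ℚ)) ^ (-T.sum) * ∑ x ∈ D, classV b p x)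
      ≤ (p : ℚ) ^ (-T.sum) * (p : ℚ) ^ (-(1 : ℤ)) := mul_le_mul_of_nonneg_left h3 (zpow_p_nonneg _)
    _ = (p : ℚ) ^ (-(T.sum + 1)) := by
        rw [← zpow_add₀ (Nat.cast_ne_zero.2 hp.out.ne_zero)]; ring_nf

/-- **THE V-CARRIER AGGREGATE BONUS.**  `‖V(b)‖_p ≤ p^{−(m+1)}` when: the carriers `D` are level classes of one common centre-free type `T`
with `ΣT = m` and a pole; every pole class outside `D` has `ν ≥ m + 1`; and `Σ_{x∈D} ĝ_x ≡ 0 (mod p)`. -/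
theorem padicNorm_coeffV_le_of_carriers (b : ℕ → ℤ) (hb : InPolytope b) (hp5 : 5 ≤ p)
    (hwin : (b 0 + 2 : ℤ) < (p : ℤ) ^ 2) (m : ℤ) (D : Finset ℕ) (T : List ℤ)
    (hT : ∀ x ∈ D, IsType b p x T false) (hTm : T.sum = m) (hneg : ∃ v ∈ T, v < 0)
    (hrest : ∀ x, x < p → 1 ≤ classPoleCount b p x → x ∉ D → m + 1 ≤ classNu b p x)
    (hsum : padicNorm p (∑ x ∈ D, gHat b p x) ≤ (p : ℚ) ^ (-(1 : ℤ))) :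
    padicNorm p (coeffV b) ≤ (p : ℚ) ^ (-(m + 1)) := by
  have hDsub : D ⊆ range p := fun x hx => mem_range.2 (hT x hx).lt
  rw [coeffV_eq_sum_classV b hp.out.pos, ← sum_sdiff hDsub]
  refine (padicNorm.nonarchimedean (p := p)).trans (max_le ?_ ?_)
  · refine padicNorm.sum_le' (fun x hx => ?_) (zpow_p_nonneg _)
    obtain ⟨hxr, hxD⟩ := mem_sdiff.1 hx
    have hx' := mem_range.1 hxr
    rcases Nat.eq_zero_or_pos (classPoleCount b p x) with h0 | hpos
    · rw [classV_eq_zero_of_noPole b hb h0, padicNorm.zero]; exact zpow_p_nonneg _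
    · exact (padicNorm_classV_le b hb hp5 hwin hx' hpos).trans
        (zpow_le_zpow_right₀ one_le_p (by linarith [hrest x hx' hpos hxD]))
  · rw [← hTm]
    exact padicNorm_sum_classV_carriers_le b hb hp5 hwin D T hT hneg hsum

/-! ## §2 The aggregate congruence from the moment lemma -/

/-- **Carrier sum from the moment lemma.**  If every class has exponent `≥ −N` (`N ≥ 1`), `(N−1)p ≤ 2d + 3`, and the depth-`N` classes split as
`D ⊔ φ(D)` with `ĝ_{φ x} ≡ ĝ_x (mod p)` on `D`, then `Σ_{x∈D} ĝ_x ≡ 0 (mod p)`. -/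
theorem gHat_carrier_sum_le (b : ℕ → ℤ) (hb : InPolytope b) (hp5 : 5 ≤ p) (N : ℕ) (hN : 1 ≤ N)
    (hEN : ∀ x, x < p → -(N : ℤ) ≤ classExp b p x) (hdeg : ((N : ℤ) - 1) * p ≤ 2 * dOf b + 3)
    (D : Finset ℕ) (φ : ℕ → ℕ) (hsplit : deepClasses b p N = D ∪ D.image φ) (hdisj : Disjoint D (D.image φ))
    (hinj : Set.InjOn φ D) (hconj : ∀ x ∈ D, padicNorm p (gHat b p (φ x) - gHat b p x) ≤ (p : ℚ) ^ (-(1 : ℤ))) :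
    padicNorm p (∑ x ∈ D, gHat b p x) ≤ (p : ℚ) ^ (-(1 : ℤ)) := by
  have hM := gHatMoments_holds b p N 0 hb hp.out hp5 hN hEN (by push_cast; linarith)
  have hdeep : padicNorm p (∑ x ∈ deepClasses b p N, gHat b p x) ≤ (p : ℚ) ^ (-(1 : ℤ)) := by
    have := padicNorm_le_of_pCong hM
    simpa using this
  rw [hsplit, sum_union hdisj, sum_image hinj] at hdeep
  have hdiff : padicNorm p (∑ x ∈ D, (gHat b p (φ x) - gHat b p x)) ≤ (p : ℚ) ^ (-(1 : ℤ)) :=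
    padicNorm.sum_le' hconj (zpow_p_nonneg _)
  have e1 : 2 * ∑ x ∈ D, gHat b p x =
      (∑ x ∈ D, gHat b p x + ∑ x ∈ D, gHat b p (φ x)) - ∑ x ∈ D, (gHat b p (φ x) - gHat b p x) := by
    rw [sum_sub_distrib]; ring
  rw [← padicNorm_two_mul hp5, e1]
  exact small_sub hdeep hdiff

/-- **Conjugate of a carrier.**  For a level class of centre-free type `T` with `ΣT + 1` even, the unit of the conjugate residue
`b₀ − (x + Lp)` is `≡ ĝ_x (mod p)`. -/
theorem gHat_conj_carrier {b : ℕ → ℤ} (hb : InPolytope b) (hp5 : 5 ≤ p) {x : ℕ} {T : List ℤ}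
    (h : IsType b p x T false) (heven : Even (T.sum + 1)) :
    padicNorm p (gHat b p ((b 0).toNat - (x + (T.length - 1) * p)) - gHat b p x) ≤ (p : ℚ) ^ (-(1 : ℤ)) := by
  obtain ⟨hxp, hL, hL', he, hc⟩ := levelData h
  have hg := gHat_conj_level b hxp hL hL' hb hp5 (fun k => T.getD k 0) he hc
  rwa [typeExp_getD T h.pos, Even.neg_one_zpow heven, one_mul] at hg

/-! ## §3 The Casoratian from `V`-bounds (THEOREM LB's assembly with the constant terms as input) -/

/-- **`v_p(Cas_j(b)) ≥ v + r` from `‖V(b)‖, ‖V(b + e_j)‖ ≤ p^{−v}`** and a row constant `r` with `r ≤ 1`, `r ≤ 3 + E_x` for every multipole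
class `x`, and `r ≤ 0` unless `p ≤ d` (rows bounded termwise by `MultipoleClassKBound` / `SinglePoleKBound`, the Ω-bracket by
`MomentVanishing`/`MomentIntegral`, exactly as in `casoratianClassBound_holds` / `casoratianOrbitBound_holds`). -/
theorem cas_val_ge_of_coeffV (b : ℕ → ℤ) {j : ℕ} (hb : InPolytope b) (hj1 : 1 ≤ j) (hj7 : j ≤ 7)
    (hb' : InPolytope (shift b j)) (hp5 : 5 ≤ p) (hwin : (b 0 + 2 : ℤ) < (p : ℤ) ^ 2) (v r : ℤ)
    (hVb : padicNorm p (coeffV b) ≤ (p : ℚ) ^ (-v)) (hVb' : padicNorm p (coeffV (shift b j)) ≤ (p : ℚ) ^ (-v))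
    (hr1 : r ≤ 1) (hrm : ∀ x, x < p → 2 ≤ classPoleCount b p x → r ≤ 3 + classExp b p x)
    (hr0 : dOf b < (p : ℤ) → r ≤ 0) (hcas : casoratian b j ≠ 0) :
    v + r ≤ padicValRat p (casoratian b j) := by
  have hp1 : (1 : ℚ) ≤ p := one_le_p
  have h0' : shift b j 0 = b 0 := shift_zero b hj1
  have hwin' : (shift b j 0 + 2 : ℤ) < (p : ℤ) ^ 2 := by rw [h0']; exact hwin
  have hbox : InBox b := hb.1
  have hcnt : ∀ x, classPoleCount (shift b j) p x ≤ classPoleCount b p x :=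
    fun x => classPoleCount_shift_le b hbox hj1 p x
  -- the rows
  have hrow : ∀ x ∈ range p,
      padicNorm p (classK (shift b j) p x * coeffV b - classK b p x * coeffV (shift b j)) ≤ (p : ℚ) ^ (-(v + r)) := by
    intro x hx
    have hx' := mem_range.1 hx
    rcases Nat.lt_trichotomy (classPoleCount b p x) 1 with hc | hc | hc
    · have h0 : classPoleCount b p x = 0 := by omega
      have h0s : classPoleCount (shift b j) p x = 0 := by have := hcnt x; omega
      rw [classK_eq_zero_of_noPole b hb h0, classK_eq_zero_of_noPole _ hb' h0s, zero_mul, zero_mul, sub_zero,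
        padicNorm.zero]
      exact zpow_p_nonneg _
    · have hK : padicNorm p (classK b p x) ≤ (p : ℚ) ^ (-(1 : ℤ)) := padicNorm_classK_le_single b hb hp5 hwin hx' hc
      have hK' : padicNorm p (classK (shift b j) p x) ≤ (p : ℚ) ^ (-(1 : ℤ)) := by
        rcases Nat.eq_zero_or_pos (classPoleCount (shift b j) p x) with h0s | hpos
        · rw [classK_eq_zero_of_noPole _ hb' h0s, padicNorm.zero]; exact zpow_p_nonneg _
        · exact padicNorm_classK_le_single _ hb' hp5 hwin' hx' (by have := hcnt x; omega)
      refine (padicNorm.sub (p := p)).trans (max_le ?_ ?_)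
      · exact (padicNorm_mul_le hK' hVb).trans (zpow_le_zpow_right₀ hp1 (by linarith))
      · exact (padicNorm_mul_le hK hVb').trans (zpow_le_zpow_right₀ hp1 (by linarith))
    · have hr3 : r ≤ 3 + classExp b p x := hrm x hx' (by omega)
      have hK : padicNorm p (classK b p x) ≤ (p : ℚ) ^ (-(3 + classExp b p x)) :=
        padicNorm_classK_le_multi b hb hp5 hwin hx' (by omega)
      have hK' : padicNorm p (classK (shift b j) p x) ≤ (p : ℚ) ^ (-(3 + classExp b p x)) := by
        rcases Nat.eq_zero_or_pos (classPoleCount (shift b j) p x) with h0s | hpos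
        · rw [classK_eq_zero_of_noPole _ hb' h0s, padicNorm.zero]; exact zpow_p_nonneg _
        · exact (padicNorm_classK_le_multi _ hb' hp5 hwin' hx' hpos).trans
            (zpow_le_zpow_right₀ hp1 (by linarith [classExp_shift_ge b hbox hj1 p x]))
      refine (padicNorm.sub (p := p)).trans (max_le ?_ ?_)
      · exact (padicNorm_mul_le hK' hVb).trans (zpow_le_zpow_right₀ hp1 (by linarith))
      · exact (padicNorm_mul_le hK hVb').trans (zpow_le_zpow_right₀ hp1 (by linarith))
  have hB : padicNorm p (kRes (shift b j) p * coeffV b - kRes b p * coeffV (shift b j)) ≤ (p : ℚ) ^ (-(v + r)) := by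
    rw [kRes_eq_sum_classK (shift b j) hp.out.pos, kRes_eq_sum_classK b hp.out.pos, sum_mul, sum_mul, ← sum_sub_distrib]
    exact padicNorm.sum_le' hrow (zpow_p_nonneg _)
  -- the Ω-bracket and the assembly
  apply val_ge_of_padicNorm_le hcas
  rw [casoratian_split b j p]
  have hdshift : dOf (shift b j) = dOf b - 1 := dOf_shift b hj1 hj7
  by_cases hpd : (p : ℤ) ≤ dOf b
  · rw [omegaRes_eq_zero b hb (by omega), omegaRes_eq_zero (shift b j) hb' (by rw [hdshift]; omega), zero_mul,
      zero_mul, sub_zero, zero_sub, padicNorm.neg]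
    exact hB
  · have hr0' : r ≤ 0 := hr0 (by push Not at hpd; exact hpd)
    refine (padicNorm.sub (p := p)).trans (max_le ?_ hB)
    refine (padicNorm.sub (p := p)).trans (max_le ?_ ?_)
    · have h1 : padicNorm p (omegaRes (shift b j) p) ≤ (p : ℚ) ^ (0 : ℤ) := by
        simpa using padicNorm_omegaRes_le_one (shift b j) hb' (by omega)
      exact (padicNorm_mul_le h1 hVb).trans (zpow_le_zpow_right₀ hp1 (by linarith))
    · have h1 : padicNorm p (omegaRes b p) ≤ (p : ℚ) ^ (0 : ℤ) := by
        simpa using padicNorm_omegaRes_le_one b hb (by omega)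
      exact (padicNorm_mul_le h1 hVb').trans (zpow_le_zpow_right₀ hp1 (by linarith))

/-! ## §4 Types under the shift -/

/-- **A typed class not hit by the shift keeps its type**: if `E_x(b + e_j) = E_x(b)` then every net exponent on the class is unchanged
(`netExp_shift_eq_of_classExp_eq`), so `IsType` transfers verbatim (`b₀` and the centre are unchanged). -/
theorem isType_shift_of_classExp_eq {b : ℕ → ℤ} (hb : InPolytope b) {j : ℕ} (hj1 : 1 ≤ j) {x : ℕ} {T : List ℤ}
    {cen : Bool} (h : IsType b p x T cen) (hE : classExp (shift b j) p x = classExp b p x) :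
    IsType (shift b j) p x T cen := by
  have hnet := netExp_shift_eq_of_classExp_eq b hb.1 hj1 hE
  refine ⟨h.pos, h.lt, by rw [shift_zero b hj1]; exact h.top, by rw [shift_zero b hj1]; exact h.top', ?_, ?_⟩
  · intro k hk
    have hmem : x + k * p ∈ classSet b p x :=
      level_mem b h.lt h.top h.top' (by omega : k ≤ T.length - 1)
    rw [hnet _ hmem]
    exact h.lev k hk
  · rw [centreIn_shift b hj1]
    exact h.cen_iff

end Summit.KontsevichZagierPeriods.Zeta5Search.ClusterValuation.VCarrier
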